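import Mathlib.LinearAlgebra.Matrix.Determinant.Basic
import Mathlib.Data.Real.Basic
import Mathlib.Algebra.Order.BigOperators.Group.Finset
import Mathlib.Data.Fintype.Card
import Mathlib.Tactic.Linarith
import Mathlib.Tactic.FieldSimp
import HarnessLib

/-!
# Venture HSemireg — the skeleton of THEOREM NO-MIX (imaginary node fields): the positivity pinch, «exactly ONE nonzero entry per
# column», and «invertible + one nonzero per column ⇒ MONOMIAL» (ENGINE-W PROBE5 §16) — kernel algebra

HONEST FRAMING. Lean index of the computation cell `pub-hsemireg`, widening group ENGINE-W (code A, seat `engine-w-1`,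
gen 17). ORDERED-FIELD INEQUALITIES and a determinant ∕ pigeonhole lemma for square matrices over a commutative ring; no abelian
variety, sheaf, `Ext` group, secant structure or semiregularity map is constructed; nothing here says that HC, HC_CM or HC_AV
holds. Theorems only (0 `def`, 0 named fact, 0 `sorry`). New namespace `NoMix`.

SOURCE (the cell's own result): `widen/ENGINE-W/out/probe5/PROBE5-STIZ-A.md` §16 (v2.2, engine-w-1 g6) **THEOREM NO-MIX** as printed:
«Let `m < 0`. If `Φ ∈ U(E_ω⁶×Ê)(ℤ)` carries the seed to a class-exact W-alive class on a coordinate datum, then … the matrix of `Φ` in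
the cyclic bases is MONOMIAL … (P) POSITIVITY: in a block transport `M = (M_ij)` (`3×3` over `F` …) unitarity reads `Σ_i h′_i·M_ij·
τ(M_ik) = h_s·δ_jk`, in particular `Σ_i h′_i·N(M_ij) = h_s` for every column `j`; for `m < 0` each `N(M_ij)` … is `0` or totally
positive …, so … `N(M_ij) ≤ h_s∕h′_i =: γ_i` at BOTH real places of `F⁺`. PROOF. … By (P), `0 ≪ N(x) ≤ γ_i` at both places, so
`N_{F∕ℚ}(x) = N_{F⁺∕ℚ}(N(x)) ≤ N_{F⁺∕ℚ}(γ_i)`. Hence `Nabs(𝔫) = 1` …, and `ν := N(x)∕γ_i` is totally positive with `ν ≤ 1` at both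
places and `N_{F⁺∕ℚ}(ν) = 1`, i.e. `ν = 1`: every nonzero entry is by itself a rank-1 isometry … The column identity `Σ_i h′_i
N(M_ij) = h_s` then has every nonzero summand equal to `h_s`: exactly ONE nonzero entry per column; `M` is invertible, so `M` is
monomial.» What the kernel holds (the three general lemmas the proof chains; the number-field inputs — volume law (V), the values
`γ_i`, invertibility of `Φ` — enter BY VALUE):

* §1 **`pinch`** — two positive reals `ν₁, ν₂ ≤ 1` with `ν₁ν₂ = 1` are both `1` («`ν ≤ 1` at both places and `N_{F⁺∕ℚ}(ν) = 1`, i.e.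
  `ν = 1`»); `index_pinch` — `a > 0`, `n ≥ 1`, `a·n ≤ a` ⟹ `n = 1` («Hence `Nabs(𝔫) = 1`»); `term_le_of_sum_eq` — in a sum of
  non-negative terms equal to `h_s` every term is `≤ h_s` ((P)'s bound `N(M_ij) ≤ h_s∕h′_i`).
* §2 **`unique_nonzero_term`** — if every term of a finite sum is `0` or `h` (`h > 0`) and the sum is `h`, exactly one term is `h`
  («every nonzero summand equal to `h_s`: exactly ONE nonzero entry per column»).
* §3 **`monomial_of_det_ne_zero`** — a square matrix over a commutative ring with `det ≠ 0` and AT MOST one nonzero entry in each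
  column has its nonzero entries on the graph of a permutation: `∃ σ, M i j ≠ 0 ↔ i = σ j` («`M` is invertible, so `M` is
  monomial»); `no_zero_column_of_det_ne_zero` ∕ `no_zero_row_of_det_ne_zero` are the two determinant facts used.
WHAT IS NOT HERE: the lattices, the hermitian forms, the volume law, `F`, `F⁺`; THEOREM NO-MIX as a statement about `U(E_ω⁶×Ê)(ℤ)`.
-/

namespace Summit.Ventures.HSemireg.NoMix

open Finset

/-! ## §1 The positivity pinch and the (P) bound -/

/-- **«`ν` is totally positive with `ν ≤ 1` at both places and `N_{F⁺∕ℚ}(ν) = 1`, i.e. `ν = 1`»**: for the two real embeddings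
`ν₁, ν₂` of `ν`, `0 < ν₁ ≤ 1`, `ν₂ ≤ 1`, `ν₁ν₂ = 1` ⟹ `ν₁ = ν₂ = 1` (positivity of `ν₂` follows). [kernel] -/
theorem pinch (ν₁ ν₂ : ℝ) (h₁ : 0 < ν₁) (h₁' : ν₁ ≤ 1) (h₂' : ν₂ ≤ 1) (hN : ν₁ * ν₂ = 1) :
    ν₁ = 1 ∧ ν₂ = 1 := by
  constructor <;> nlinarith

/-- **«Hence `Nabs(𝔫) = 1`»**: `|N_{F∕ℚ}(x)| = N(γ_i)·Nabs(𝔫)` with `N(γ_i) > 0`, `Nabs(𝔫) ≥ 1` and `|N_{F∕ℚ}(x)| ≤ N(γ_i)` leave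
`Nabs(𝔫) = 1`. [kernel] -/
theorem index_pinch (a n : ℕ) (ha : 0 < a) (hn : 1 ≤ n) (hle : a * n ≤ a) : n = 1 := by
  rcases Nat.lt_or_ge 1 n with h | h
  · nlinarith
  · omega

/-- **(P)'s bound**: in `Σ_i h′_i·N(M_ij) = h_s` with every term non-negative, each term is `≤ h_s` (so `N(M_ij) ≤ h_s∕h′_i = γ_i`).
[kernel] -/
theorem term_le_of_sum_eq {k : ℕ} (c : Fin k → ℝ) (hs : ℝ) (hnonneg : ∀ i, 0 ≤ c i) (hsum : ∑ i, c i = hs) (i : Fin k) :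
    c i ≤ hs := by
  rw [← hsum]
  exact Finset.single_le_sum (fun j _ => hnonneg j) (Finset.mem_univ i)

/-- … and dividing by `h′_i > 0`: `h′_i·N ≤ h_s` ⟹ `N ≤ h_s∕h′_i`. [kernel] -/
theorem norm_le_gamma (h' N hs : ℝ) (hh : 0 < h') (hle : h' * N ≤ hs) : N ≤ hs / h' := by
  rw [le_div_iff₀ hh]
  linarith [mul_comm h' N]

/-! ## §2 Exactly one nonzero entry per column -/

/-- **«The column identity `Σ_i h′_i N(M_ij) = h_s` then has every nonzero summand equal to `h_s`: exactly ONE nonzero entry per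
column»**: if each term of a finite sum is `0` or `h` with `h > 0` and the sum equals `h`, then exactly one term equals `h` (and it
is the unique nonzero term). [kernel] -/
theorem unique_nonzero_term {k : ℕ} (c : Fin k → ℝ) (h : ℝ) (hpos : 0 < h) (hc : ∀ i, c i = 0 ∨ c i = h)
    (hsum : ∑ i, c i = h) : ∃! i, c i ≠ 0 := by
  have hnonneg : ∀ i, 0 ≤ c i := fun i => by rcases hc i with e | e <;> simp [e, hpos.le]
  -- existence: not all terms vanish
  have hex : ∃ i, c i ≠ 0 := by
    by_contra hall
    push Not at hall
    have : ∑ i, c i = 0 := Finset.sum_eq_zero (fun i _ => hall i)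
    linarith
  obtain ⟨i, hi⟩ := hex
  refine ⟨i, hi, fun j hj => ?_⟩
  by_contra hne
  have ci : c i = h := by rcases hc i with e | e; exact absurd e hi; exact e
  have cj : c j = h := by rcases hc j with e | e; exact absurd e hj; exact e
  -- two terms equal to h force the sum above h
  have hsub : ({i, j} : Finset (Fin k)) ⊆ Finset.univ := Finset.subset_univ _
  have hle := Finset.sum_le_sum_of_subset_of_nonneg hsub (fun x _ _ => hnonneg x)
  rw [Finset.sum_pair (Ne.symm hne), hsum, ci, cj] at hle
  linarith

/-! ## §3 Invertible with at most one nonzero entry per column ⇒ monomial -/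

/-- A square matrix with a zero column has determinant `0`; contrapositive: `det M ≠ 0` ⟹ every column has a nonzero entry. [kernel] -/
theorem no_zero_column_of_det_ne_zero {R : Type*} [CommRing R] {k : ℕ} (M : Matrix (Fin k) (Fin k) R) (hM : M.det ≠ 0)
    (j : Fin k) : ∃ i, M i j ≠ 0 := by
  by_contra h
  push Not at h
  exact hM (Matrix.det_eq_zero_of_column_eq_zero j h)

/-- Likewise every row of `M` has a nonzero entry when `det M ≠ 0`. [kernel] -/
theorem no_zero_row_of_det_ne_zero {R : Type*} [CommRing R] {k : ℕ} (M : Matrix (Fin k) (Fin k) R) (hM : M.det ≠ 0)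
    (i : Fin k) : ∃ j, M i j ≠ 0 := by
  by_contra h
  push Not at h
  exact hM (Matrix.det_eq_zero_of_row_eq_zero i h)

/-- **«`M` is invertible, so `M` is monomial»**: if `det M ≠ 0` and each column of `M` carries AT MOST one nonzero entry, then the
nonzero entries of `M` are exactly the graph of a permutation `σ` of the indices: `M i j ≠ 0 ⟺ i = σ j`. (Pigeonhole: the
column ↦ row map is surjective — a missed row would be a zero row — hence bijective.) [kernel] -/
theorem monomial_of_det_ne_zero {R : Type*} [CommRing R] {k : ℕ} (M : Matrix (Fin k) (Fin k) R) (hM : M.det ≠ 0)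
    (hcol : ∀ j i i', M i j ≠ 0 → M i' j ≠ 0 → i = i') :
    ∃ σ : Equiv.Perm (Fin k), ∀ i j, M i j ≠ 0 ↔ i = σ j := by
  classical
  -- the column ↦ row map
  have hcolex := no_zero_column_of_det_ne_zero M hM
  choose f hf using hcolex
  -- f is surjective: a row outside the range of f would be a zero row
  have hsurj : Function.Surjective f := by
    intro i
    obtain ⟨j, hj⟩ := no_zero_row_of_det_ne_zero M hM i
    exact ⟨j, hcol j (f j) i (hf j) hj⟩
  have hbij : Function.Bijective f := ⟨Finite.injective_iff_surjective.2 hsurj, hsurj⟩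
  refine ⟨Equiv.ofBijective f hbij, fun i j => ⟨fun h => ?_, fun h => ?_⟩⟩
  · exact hcol j i (f j) h (hf j)
  · rw [h]; exact hf j

end Summit.Ventures.HSemireg.NoMix
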